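import Summits.Ventures.Crystal3D.Theorems.StickyWulffConstantGenericWallFloorCubicCoords
import Mathlib.LinearAlgebra.Matrix.NonsingularInverse
import HarnessLib

/-!
# Independent slot triples: every open hemisphere and every seven slots contain one
# (crux `GenericWallFloor`, line `WallLedgerG`; E2 single-dozen algebra — the non-coplanarity inputs)

HONEST FRAMING. Part of the venture `Summits/Ventures/Crystal3D` (cell `crystal3d-full`), helper
`--supports` the crux `GenericWallFloor` (stmt-Ventures-19480) of `route-Ventures-StickyWulffConstant`,
registered line `WallLedgerG`, open stub `stub_twoSlabAdhesion` — general-filling step, per-ball programme E2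
(cf-p1 ROUTE.md §80(8)–(9)).  The dozen rigidity of `…SlotDozens` / `…ShellTrichotomy` asks for three
LINEARLY INDEPENDENT occupied slots; this file supplies them in the two situations the coverage flow uses:

* **`exists_independent_slots_of_hemisphere`** — for every grain frame `A` and every `ν ≠ 0` the open
  hemisphere pattern `{w ∈ fccSlots : ⟪A w, ν⟫ < 0}` contains three linearly independent slots (a ball
  whose «lower hemisphere» is occupied has a non-coplanar own pattern);
* **`exists_independent_slots_of_seven_le`** — any `S ⊆ fccSlots` with `7 ≤ #S` contains three linearly
  independent slots (a plane through the centre holds at most six slots).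

Method: the cubic frame of `…CubicCoords` (`slotSite : Fin 12 → Λ₀`, `cubicCoords (slotSite k) = slotVec k`,
integer models `slotInt`, `crossInt` of `…CutNormals`); a non-zero integer triple product
`slotInt i ⬝ crossInt (slotInt j) (slotInt k)` makes the three slots independent
(`linearIndependent_slotSite`, via `Matrix.eq_zero_of_vecMul_eq_zero`); the finite facts (antipodes, at most
six slots in a slot plane, independent triples off any axis / plane) are kernel `decide`s over `Fin 12`; the
hemisphere lemma is then a two-plane argument (the negative slots of `ν` would lie in a plane and the twelve
slots would be covered by that plane and `ν^⊥`, impossible).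

WHAT THIS IS NOT: nothing about packings; rung F-C1 not moved.
-/

noncomputable section

namespace Summit.Ventures.Crystal3D.Theorems

open Finset Matrix NearIdentity
open scoped InnerProductSpace

/-! ### Integer bookkeeping over the twelve slot indices (kernel `decide`) -/

/-- `slotInt` is injective. -/
theorem slotInt_injective : Function.Injective slotInt := by decide

/-- Every slot has an antipode, and exactly one. -/
theorem slotInt_antipode : ∀ i : Fin 12, ∃ j : Fin 12, slotInt j = -slotInt i := by decide

/-- Exactly one antipode. -/
theorem card_antipode (a : Fin 12) : (univ.filter fun m : Fin 12 => slotInt m = -slotInt a).card = 1 := by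
  revert a; decide

/-- Three independent slots exist. -/
theorem det_slot_048 : slotInt 0 ⬝ᵥ crossInt (slotInt 4) (slotInt 8) ≠ 0 := by decide

/-- Off every slot axis there are three independent slots. -/
theorem exists_indep_off_axis : ∀ i : Fin 12, ∃ j k l : Fin 12,
    (slotInt j ≠ slotInt i ∧ slotInt j ≠ -slotInt i) ∧ (slotInt k ≠ slotInt i ∧ slotInt k ≠ -slotInt i) ∧
    (slotInt l ≠ slotInt i ∧ slotInt l ≠ -slotInt i) ∧ slotInt j ⬝ᵥ crossInt (slotInt k) (slotInt l) ≠ 0 := by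
  decide

/-- Off every slot plane (spanned by two non-parallel slots) there are three independent slots. -/
theorem exists_indep_off_plane : ∀ a b : Fin 12, slotInt b ≠ slotInt a → slotInt b ≠ -slotInt a →
    ∃ k l m : Fin 12, slotInt a ⬝ᵥ crossInt (slotInt b) (slotInt k) ≠ 0 ∧
      slotInt a ⬝ᵥ crossInt (slotInt b) (slotInt l) ≠ 0 ∧ slotInt a ⬝ᵥ crossInt (slotInt b) (slotInt m) ≠ 0 ∧
      slotInt k ⬝ᵥ crossInt (slotInt l) (slotInt m) ≠ 0 := by
  decide

/-- A slot plane contains at most six slots (hexagon `6`, square `4`). -/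
theorem card_slot_plane_le : ∀ a b : Fin 12, slotInt b ≠ slotInt a → slotInt b ≠ -slotInt a →
    (univ.filter fun m : Fin 12 => slotInt a ⬝ᵥ crossInt (slotInt b) (slotInt m) = 0).card ≤ 6 := by
  decide

/-- The triple product changes sign with the third slot. -/
theorem det_neg_third (x y z : Fin 3 → ℤ) : x ⬝ᵥ crossInt y (-z) = -(x ⬝ᵥ crossInt y z) := by
  simp [crossInt, dotProduct, Fin.sum_univ_three]; ring

/-! ### Real side: slots in the cubic frame -/

/-- Antipodal indices give antipodal slots. -/
theorem slotSite_eq_neg {i j : Fin 12} (h : slotInt j = -slotInt i) : slotSite j = -slotSite i := by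
  apply cubicCoords_injective
  rw [show -slotSite i = (-1 : ℝ) • slotSite i by simp, cubicCoords_smul, cubicCoords_slotSite,
    cubicCoords_slotSite]
  ext c
  simp [slotVec, h]
  ring

/-- Equal integer models give equal slots (and conversely `slotSite` is injective). -/
theorem slotSite_eq_iff {i j : Fin 12} : slotSite j = slotSite i ↔ j = i :=
  ⟨fun h => slotSite_injective h, fun h => by rw [h]⟩

/-- **A non-zero triple product makes three slots linearly independent.** -/
theorem linearIndependent_slotSite {i j k : Fin 12}
    (h : slotInt i ⬝ᵥ crossInt (slotInt j) (slotInt k) ≠ 0) :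
    LinearIndependent ℝ ![slotSite i, slotSite j, slotSite k] := by
  classical
  rw [Fintype.linearIndependent_iff]
  intro g hg
  -- pass to cubic coordinates, then to the integer rows scaled by `√2`
  set M : Matrix (Fin 3) (Fin 3) ℝ := Matrix.of fun r c => (slotInt (![i, j, k] r) c : ℝ) with hM
  have hdet : M.det ≠ 0 := by
    have e : M.det = ((slotInt i ⬝ᵥ crossInt (slotInt j) (slotInt k) : ℤ) : ℝ) := by
      rw [Matrix.det_fin_three]
      simp [hM, crossInt, dotProduct, Fin.sum_univ_three]
      ring
    rw [e]; exact_mod_cast h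
  have hvec : g ᵥ* M = 0 := by
    have hc := congrArg cubicCoords hg
    simp only [Fin.sum_univ_three, Matrix.cons_val_zero, Matrix.cons_val_one, Matrix.cons_val,
      cubicCoords_add, cubicCoords_smul, cubicCoords_slotSite] at hc
    have hc0 : cubicCoords (0 : EuclideanSpace ℝ (Fin 3)) = 0 := by
      have := cubicCoords_smul 0 (0 : EuclideanSpace ℝ (Fin 3))
      rwa [zero_smul, zero_smul] at this
    rw [hc0] at hc
    ext c
    have hcc := congrFun hc c
    simp only [Pi.add_apply, Pi.smul_apply, smul_eq_mul, slotVec, Pi.zero_apply] at hcc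
    simp only [Matrix.vecMul, dotProduct, Fin.sum_univ_three, hM, Matrix.of_apply, Matrix.cons_val_zero,
      Matrix.cons_val_one, Matrix.cons_val, Pi.zero_apply]
    have hs : Real.sqrt 2 ≠ 0 := by positivity
    field_simp at hcc
    linarith
  have := Matrix.eq_zero_of_vecMul_eq_zero hdet hvec
  intro r
  exact congrFun this r

/-- Three independent slots orthogonal to `ν` force `ν = 0`. -/
theorem eq_zero_of_inner_slotSite_eq_zero {i j k : Fin 12}
    (h : slotInt i ⬝ᵥ crossInt (slotInt j) (slotInt k) ≠ 0) {ν : EuclideanSpace ℝ (Fin 3)}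
    (hi : ⟪slotSite i, ν⟫_ℝ = 0) (hj : ⟪slotSite j, ν⟫_ℝ = 0) (hk : ⟪slotSite k, ν⟫_ℝ = 0) : ν = 0 := by
  have hli := linearIndependent_slotSite h
  have hspan := hli.span_eq_top_of_card_eq_finrank' (by simp)
  have hν : ν ∈ Submodule.span ℝ (Set.range ![slotSite i, slotSite j, slotSite k]) := by
    rw [hspan]; exact Submodule.mem_top
  obtain ⟨c, hc⟩ := (Submodule.mem_span_range_iff_exists_fun ℝ).1 hν
  simp only [Fin.sum_univ_three, Matrix.cons_val_zero, Matrix.cons_val_one, Matrix.cons_val] at hc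
  have : ⟪ν, ν⟫_ℝ = 0 := by
    calc ⟪ν, ν⟫_ℝ = ⟪c 0 • slotSite i + c 1 • slotSite j + c 2 • slotSite k, ν⟫_ℝ := by rw [hc]
      _ = 0 := by simp only [inner_add_left, real_inner_smul_left, hi, hj, hk, mul_zero, add_zero]
  exact inner_self_eq_zero.1 this

/-! ### Every open hemisphere contains three independent slots -/

/-- **Hemisphere lemma, index form.**  For `ν ≠ 0` there are three slots `sᵢ, sⱼ, sₖ` with
`⟪s, ν⟫ < 0` and non-zero triple product. -/
theorem exists_neg_indep_slots {ν : EuclideanSpace ℝ (Fin 3)} (hν : ν ≠ 0) :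
    ∃ i j k : Fin 12, ⟪slotSite i, ν⟫_ℝ < 0 ∧ ⟪slotSite j, ν⟫_ℝ < 0 ∧ ⟪slotSite k, ν⟫_ℝ < 0 ∧
      slotInt i ⬝ᵥ crossInt (slotInt j) (slotInt k) ≠ 0 := by
  by_contra H
  push Not at H
  -- antipodes flip the sign
  have flip : ∀ m : Fin 12, 0 < ⟪slotSite m, ν⟫_ℝ → ∃ m', slotInt m' = -slotInt m ∧ ⟪slotSite m', ν⟫_ℝ < 0 := by
    intro m hm
    obtain ⟨m', hm'⟩ := slotInt_antipode m
    refine ⟨m', hm', ?_⟩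
    rw [slotSite_eq_neg hm', inner_neg_left]; linarith
  -- Step 0: some slot is strictly negative
  have hex : ∃ a : Fin 12, ⟪slotSite a, ν⟫_ℝ < 0 := by
    by_contra h0
    push Not at h0
    have hz : ∀ m : Fin 12, ⟪slotSite m, ν⟫_ℝ = 0 := by
      intro m
      rcases (h0 m).lt_or_eq with hpos | heq
      · obtain ⟨m', -, hneg⟩ := flip m hpos
        exact absurd (h0 m') (not_le.2 hneg)
      · exact heq.symm
    exact hν (eq_zero_of_inner_slotSite_eq_zero det_slot_048 (hz 0) (hz 4) (hz 8))
  obtain ⟨a, ha⟩ := hex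
  by_cases hpar : ∀ b : Fin 12, ⟪slotSite b, ν⟫_ℝ < 0 → b = a
  · -- Case A: `a` is the only negative slot; then every slot off the axis of `a` is orthogonal to `ν`
    have hz : ∀ m : Fin 12, slotInt m ≠ slotInt a → slotInt m ≠ -slotInt a → ⟪slotSite m, ν⟫_ℝ = 0 := by
      intro m hm1 hm2
      rcases lt_trichotomy ⟪slotSite m, ν⟫_ℝ 0 with hlt | heq | hgt
      · exact absurd (hpar m hlt) (fun e => hm1 (by rw [e]))
      · exact heq
      · obtain ⟨m', hm', hneg⟩ := flip m hgt
        have : m' = a := hpar m' hneg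
        rw [this] at hm'
        exact absurd (by rw [hm', neg_neg]) hm2
    obtain ⟨j, k, l, ⟨hj1, hj2⟩, ⟨hk1, hk2⟩, ⟨hl1, hl2⟩, hdet⟩ := exists_indep_off_axis a
    exact hν (eq_zero_of_inner_slotSite_eq_zero hdet (hz j hj1 hj2) (hz k hk1 hk2) (hz l hl1 hl2))
  · -- Case B: a second negative slot `b`; then every slot off the plane of `a, b` is orthogonal to `ν`
    push Not at hpar
    obtain ⟨b, hb, hba⟩ := hpar
    have hb1 : slotInt b ≠ slotInt a := fun e => hba (slotInt_injective e)
    have hb2 : slotInt b ≠ -slotInt a := by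
      intro e
      have := slotSite_eq_neg e
      rw [this, inner_neg_left] at hb
      linarith
    have hz : ∀ m : Fin 12, slotInt a ⬝ᵥ crossInt (slotInt b) (slotInt m) ≠ 0 → ⟪slotSite m, ν⟫_ℝ = 0 := by
      intro m hm
      rcases lt_trichotomy ⟪slotSite m, ν⟫_ℝ 0 with hlt | heq | hgt
      · exact absurd hm (not_not.2 (H a b m ha hb hlt))
      · exact heq
      · obtain ⟨m', hm', hneg⟩ := flip m hgt
        have hdet' : slotInt a ⬝ᵥ crossInt (slotInt b) (slotInt m') ≠ 0 := by
          rw [hm', det_neg_third]; exact neg_ne_zero.2 hm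
        exact absurd hdet' (not_not.2 (H a b m' ha hb hneg))
    obtain ⟨k, l, m, hk, hl, hm, hdet⟩ := exists_indep_off_plane a b hb1 hb2
    exact hν (eq_zero_of_inner_slotSite_eq_zero hdet (hz k hk) (hz l hl) (hz m hm))

/-- **HEMISPHERE LEMMA.**  For every grain frame `A` and every `ν ≠ 0`, the open hemisphere pattern
`{w ∈ fccSlots : ⟪A w, ν⟫ < 0}` contains three LINEARLY INDEPENDENT slots.  (So a ball whose «lower
hemisphere» slots are occupied — the coverage-flow hypothesis of E3 — has a non-coplanar own pattern.) -/
theorem exists_independent_slots_of_hemisphere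
    (A : EuclideanSpace ℝ (Fin 3) ≃ₗᵢ[ℝ] EuclideanSpace ℝ (Fin 3)) {ν : EuclideanSpace ℝ (Fin 3)} (hν : ν ≠ 0) :
    ∃ w₁ ∈ fccSlots, ∃ w₂ ∈ fccSlots, ∃ w₃ ∈ fccSlots,
      ⟪A w₁, ν⟫_ℝ < 0 ∧ ⟪A w₂, ν⟫_ℝ < 0 ∧ ⟪A w₃, ν⟫_ℝ < 0 ∧ LinearIndependent ℝ ![w₁, w₂, w₃] := by
  have hν' : A.symm ν ≠ 0 := by
    intro h; exact hν (by simpa using congrArg A h)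
  obtain ⟨i, j, k, hi, hj, hk, hdet⟩ := exists_neg_indep_slots hν'
  have flipA : ∀ w, ⟪A w, ν⟫_ℝ = ⟪w, A.symm ν⟫_ℝ := fun w => by
    rw [← A.inner_map_map w (A.symm ν), LinearIsometryEquiv.apply_symm_apply]
  refine ⟨slotSite i, slotSite_mem i, slotSite j, slotSite_mem j, slotSite k, slotSite_mem k, ?_, ?_, ?_,
    linearIndependent_slotSite hdet⟩ <;> rwa [flipA]

/-! ### Any seven slots contain three independent ones -/

/-- **SEVEN-SLOT LEMMA.**  Any seven slots contain three linearly independent ones (a plane through the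
centre contains at most six slots). -/
theorem exists_independent_slots_of_seven_le {S : Finset (EuclideanSpace ℝ (Fin 3))}
    (hS : S ⊆ fccSlots) (h7 : 7 ≤ S.card) :
    ∃ w₁ ∈ S, ∃ w₂ ∈ S, ∃ w₃ ∈ S, LinearIndependent ℝ ![w₁, w₂, w₃] := by
  classical
  set I : Finset (Fin 12) := univ.filter fun m => slotSite m ∈ S with hI
  have hSI : S = I.image slotSite := by
    ext w
    constructor
    · intro hw
      obtain ⟨m, hm⟩ := exists_slotSite_eq (hS hw)
      exact mem_image.2 ⟨m, mem_filter.2 ⟨mem_univ _, hm ▸ hw⟩, hm⟩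
    · intro hw
      obtain ⟨m, hm, rfl⟩ := mem_image.1 hw
      exact (mem_filter.1 hm).2
  have hcardI : 7 ≤ I.card := by
    rw [hSI, card_image_of_injective _ slotSite_injective] at h7; exact h7
  have memI : ∀ {m}, m ∈ I → slotSite m ∈ S := fun hm => (mem_filter.1 hm).2
  -- pick `a ∈ I`, then `b ∈ I` off the axis of `a`
  obtain ⟨a, ha⟩ : I.Nonempty := card_pos.1 (by omega)
  have hoff : ((I.erase a).filter fun m => ¬ slotInt m = -slotInt a).Nonempty := by
    rw [← card_pos]
    have h1 : (I.erase a).card + 1 = I.card := card_erase_add_one ha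
    have h2 : ((I.erase a).filter fun m => slotInt m = -slotInt a).card ≤ 1 := by
      calc ((I.erase a).filter fun m => slotInt m = -slotInt a).card
          ≤ (univ.filter fun m : Fin 12 => slotInt m = -slotInt a).card :=
            card_le_card (filter_subset_filter _ (subset_univ _))
        _ = 1 := card_antipode a
    have h3 := Finset.card_filter_add_card_filter_not (s := I.erase a) (fun m => slotInt m = -slotInt a)
    omega
  obtain ⟨b, hb⟩ := hoff
  obtain ⟨hb', hb2⟩ := mem_filter.1 hb
  obtain ⟨hba, hbI⟩ := mem_erase.1 hb'
  have hb1 : slotInt b ≠ slotInt a := fun e => hba (slotInt_injective e)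
  -- the plane of `a, b` holds at most six slots, so some `m ∈ I` is off it
  have hplane := card_slot_plane_le a b hb1 hb2
  have hex : ∃ m ∈ I, slotInt a ⬝ᵥ crossInt (slotInt b) (slotInt m) ≠ 0 := by
    by_contra h0
    push Not at h0
    have hsub : I ⊆ univ.filter fun m : Fin 12 => slotInt a ⬝ᵥ crossInt (slotInt b) (slotInt m) = 0 :=
      fun m hm => mem_filter.2 ⟨mem_univ _, h0 m hm⟩
    have := card_le_card hsub
    omega
  obtain ⟨m, hmI, hdet⟩ := hex
  exact ⟨slotSite a, memI ha, slotSite b, memI hbI, slotSite m, memI hmI, linearIndependent_slotSite hdet⟩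

end Summit.Ventures.Crystal3D.Theorems

end
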